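import Literature.AlgebraicGeometry.Resolution.PointBlowupElimination

/-!
# The Kawanoue–Matsuki monomial-case invariants `inv_{MON,♥}`, `inv_{MON,♠}` (statement-level typing)

H. Kawanoue, K. Matsuki, *A new strategy for resolution of singularities in the monomial case in positive
characteristic*, Rev. Mat. Iberoam. **34** (2018) 1229–1276 = arXiv:1507.05195 [KM18], is Step 2 ("solution in
the monomial case") of the Idealistic Filtration Program in dimension 3: at a closed point `P ∈ Sing(ℛ)` in the
monomial case (setting 2.1: a leading generator `h = x^{p^e} + a_1x^{p^e−1} + ⋯ + a_{p^e}`, a monomial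
`M = ∏_{D ∈ E_young} x_D^{m_D}` with `(M,a) ∈ ℛ_P` and `Σ m_D > a`) they set `μ(ξ_D) = m_D/a`,
`μ(P) = Σ_D μ(ξ_D) = ord_P(M_usual)` (4.1), define the invariant `H` as the slope of a well-adapted `h`
(Def. 1–2) and show `H(P) = min{ord_P(a_{p^e})/p^e, μ(P)}` for a well-adapted `h` (Prop. 1 (2)); they define
`M_tight = ∏ x_D^{H(ξ_D)}` (Def. 3), good/bad points and divisors (Def. 4), `ρ_D` and
`w-ρ_D = res-ord_P(x^r g_x)/p^e − ord_P(M_tight)` (Def. 5), `inv_{MON,♥}(P) = H(P) − ord_P(M_tight)` and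
`inv_{MON,♠}(P) = lex{A,B}` — `A` the word of the `w-ρ_D` of the bad divisors in increasing order (`0` if there is
none or a letter vanishes), `B = ord_P(M_usual) − ord_P(M_tight)`, words ordered lexicographically with a proper
prefix smaller and `0` the minimum, `lex{A,B} = (min, max)` (Def. 6) —, tightness `inv_{MON,♥} = 0` (Def. 7,
Prop. 2: then `(σ, 0, Γ_tight)` strictly decreases), the algorithm 5.1 (blow up `V(x,x_D)` for the `D` with the
largest `H(ξ_D) ≥ 1` if `dim Sing(ℛ)_P = 1`, else the point), configurations 1–5 (5.2), standard / esoteric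
point blow-ups (Def. 8: esoteric iff `A < Ã`; only then can `inv_{MON,♠}` increase, Prop. 3), the analysis of
the jumping phenomenon (Prop. 6, with Moh's inequality (♣2) `(w-ρ_{x̃}(P̃) − inv_{MON,♥}(P))·p^e ≤ p^{e−1}`) and
the eventual decrease (Prop. 7), whence termination (Cor. 2).  [cite: KawanoueMatsuki2018, §2, §4–§6]

This file types the DATA and the ORDER of [KM18] at the statement level, over an index type `ι` of coordinate
hyperplanes, with values in `ℚ`: `Datum` (the numbers `p^e`, `ord_P(a_{p^e})`, `E_young`, `μ(ξ_D)`,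
`ord_{ξ_D}(a_{p^e})`, `res-ord_P(x_D^r g_{x_D})` read at a point), the derived invariants `HP`, `Hxi`,
`ordMtight`, `invHeart`, `wrho`, `wordA`, `B`, `invSpade`, the predicates `IsGoodPoint / IsGoodDiv / IsTight`,
the centre predicates of algorithm 5.1, the configuration, and the edge predicates `Esoteric / Increases` with the
bound `MohJumpBound` of (♣2).  The order on words is transcribed as the recursive `WordLT` (Def. 6 (i)) and
`lex{A,B}` as `lexPair / PairLT` (Def. 6 (ii)–(iii)).  They are DEFINITIONS and PREDICATES, never asserted: the
theorems of [KM18] carry the analytic setting 2.1 (the idealistic filtration, `E_young`, well-adaptedness), whose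
identification with the point-blowup walk of `PointBlowupShade` / `PointBlowupElimination` — `a_{p^e} :=` the
cleaned `F`, `μ(ξ_{u_i}) := α_i` of the transported elimination algebra in its weakly-monomial case, `E_young :=`
the exceptional curves through the point — is a recorded convention of the atlas (dictionary D9), not a theorem of
this file.  The computable twin with kernel-checked rows is `KangarooAtlasCertIFPMonomial`.  What is NOT here:
`σ`, `μ̃`, `τ`, `E_aged`, `Γ_tight` as an invariant with values in a well-order, the transformation laws of
`a_{p^e}` (they live on the walk states), and any decrease statement.
-/

noncomputable section

namespace Literature.AlgebraicGeometry.Resolution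

namespace IFPMonomial

/-! ### Words and `lex{A,B}` ([KM18] Def. 6) -/

/-- The strict order on words (finite sequences of rationals): lexicographic, a proper prefix is smaller, and the
empty word — the symbol `0` of [KM18] — is the minimum. [cite: KawanoueMatsuki2018, Def. 6 (i)] -/
def WordLT : List ℚ → List ℚ → Prop
  | _, [] => False
  | [], _ :: _ => True
  | a :: u, b :: v => a < b ∨ (a = b ∧ WordLT u v)

/-- `lex{A,B} := (min{A,B}, max{A,B})` for a word `A` and a number `B` (identified with the one-letter word `(B)`);
the value `0` — taken when `A = 0` or `B = 0` — is `none`. [cite: KawanoueMatsuki2018, Def. 6 (ii)–(iii), Def. 6 (2)(iii)] -/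
def lexPair (A : List ℚ) (B : ℚ) : Option (List ℚ × List ℚ) := by
  classical
  exact if A = [] ∨ B = 0 then none else if WordLT A [B] then some (A, [B]) else some ([B], A)

/-- The strict lexicographic order on the values `lex{A,B}`, `none = 0` being the minimum.
[cite: KawanoueMatsuki2018, Def. 6 (ii)] -/
def PairLT : Option (List ℚ × List ℚ) → Option (List ℚ × List ℚ) → Prop
  | _, none => False
  | none, some _ => True
  | some (a, b), some (c, d) => WordLT a c ∨ (a = c ∧ WordLT b d)

/-- `0` is the minimum of the order on words. [cite: KawanoueMatsuki2018, Def. 6 (i)] -/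
theorem not_wordLT_zero (w : List ℚ) : ¬ WordLT w [] := by
  cases w <;> simp [WordLT]

/-- `0` is the minimum of the order on the values `lex{A,B}`. [cite: KawanoueMatsuki2018, Def. 6 (ii)] -/
theorem not_pairLT_zero (v : Option (List ℚ × List ℚ)) : ¬ PairLT v none := by
  cases v <;> simp [PairLT]

/-! ### The datum at a point and the invariants ([KM18] §4) -/

/-- The numbers read at a closed point `P` in the monomial case, over an index type `ι` of coordinate
hyperplanes `{x_D = 0}`: `q = p^e` (the level of the leading generator `h = x^{p^e} + ⋯ + a_{p^e}`),
`d = ord_P(a_{p^e})`, the components `young ⊆ ι` of `E_young` through `P`, `mu D = μ(ξ_D) = m_D/a`,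
`ordXi D = ord_{ξ_D}(a_{p^e})`, and `resOrd D = res-ord_P(x_D^{r} g_{x_D})` (the residual order of the
initial term of `a_{p^e}` along `D`). [cite: KawanoueMatsuki2018, 2.1, 4.1, 4.2 B, Def. 5] -/
structure Datum (ι : Type*) where
  /-- `p^e` -/
  q : ℕ
  /-- `ord_P(a_{p^e})` -/
  d : ℕ
  /-- the components of `E_young` passing through `P` -/
  young : Finset ι
  /-- `μ(ξ_D) = m_D / a` -/
  mu : ι → ℚ
  /-- `ord_{ξ_D}(a_{p^e})` -/
  ordXi : ι → ℕ
  /-- `res-ord_P(x_D^{r} g_{x_D})`, `r = ord_{ξ_D}(a_{p^e})` -/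
  resOrd : ι → ℕ

namespace Datum

variable {ι : Type*} (δ : Datum ι)

/-- `μ(P) = Σ_{D ∈ E_young, P ∈ D} μ(ξ_D) = ord_P(M_usual)`. [cite: KawanoueMatsuki2018, 4.1] -/
def muP : ℚ := ∑ D ∈ δ.young, δ.mu D

/-- `H(P) = min{ord_P(a_{p^e})/p^e, μ(P)}` for a well-adapted `h`. [cite: KawanoueMatsuki2018, Prop. 1 (2)] -/
def HP : ℚ := min ((δ.d : ℚ) / δ.q) δ.muP

/-- `H(ξ_D) = min{ord_{ξ_D}(a_{p^e})/p^e, μ(ξ_D)}` for an `h` well-adapted at `ξ_D`. [cite: KawanoueMatsuki2018, Prop. 1 (2)] -/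
def Hxi (D : ι) : ℚ := min ((δ.ordXi D : ℚ) / δ.q) (δ.mu D)

/-- `P` is a good point iff `ord_P(a_{p^e})/p^e ≥ μ(P)` (else bad). [cite: KawanoueMatsuki2018, Def. 4 (1)] -/
def IsGoodPoint : Prop := δ.muP ≤ (δ.d : ℚ) / δ.q

/-- `D` is a good divisor iff `ord_{ξ_D}(a_{p^e})/p^e ≥ μ(ξ_D)` (else bad). [cite: KawanoueMatsuki2018, Def. 4 (2)] -/
def IsGoodDiv (D : ι) : Prop := δ.mu D ≤ (δ.ordXi D : ℚ) / δ.q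

/-- the bad components of `E_young` through `P`. [cite: KawanoueMatsuki2018, Def. 4 (2)] -/
def bad : Finset ι := by
  classical
  exact δ.young.filter (fun D => ¬ δ.IsGoodDiv D)

/-- `ord_P(M_tight) = Σ_D H(ξ_D)`, `M_tight = ∏ x_D^{H(ξ_D)}`. [cite: KawanoueMatsuki2018, Def. 3] -/
def ordMtight : ℚ := ∑ D ∈ δ.young, δ.Hxi D

/-- `inv_{MON,♥}(P) = H(P) − ord_P(M_tight)`. [cite: KawanoueMatsuki2018, Def. 6 (1)] -/
def invHeart : ℚ := δ.HP - δ.ordMtight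

/-- the tight monomial case: `inv_{MON,♥}(P) = 0`. [cite: KawanoueMatsuki2018, Def. 7] -/
def IsTight : Prop := δ.invHeart = 0

/-- `ρ_D = (res-ord_P(x^r g_x) − r)/p^e` for a bad divisor `D`. [cite: KawanoueMatsuki2018, Def. 5] -/
def rho (D : ι) : ℚ := ((δ.resOrd D : ℚ) - δ.ordXi D) / δ.q

/-- `w-ρ_D = res-ord_P(x^r g_x)/p^e − ord_P(M_tight)` for a bad divisor `D`. [cite: KawanoueMatsuki2018, Def. 5] -/
def wrho (D : ι) : ℚ := (δ.resOrd D : ℚ) / δ.q - δ.ordMtight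

/-- `B = ord_P(M_usual) − ord_P(M_tight)`. [cite: KawanoueMatsuki2018, Def. 6 (2)(ii)] -/
def B : ℚ := δ.muP - δ.ordMtight

/-- the word `A = (w-ρ_{x_{l₁}}, …, w-ρ_{x_{l_b}})` of the bad divisors in increasing order; `A = 0 = []` when there is no bad
divisor or one letter is `0` (then all are). [cite: KawanoueMatsuki2018, Def. 6 (2)(i)] -/
def wordA : List ℚ := by
  classical
  exact
    let ws := (δ.bad.toList.map δ.wrho).insertionSort (· ≤ ·)
    if ws = [] ∨ (0 : ℚ) ∈ ws then [] else ws

/-- `inv_{MON,♠}(P) = lex{A,B}` (`none` = the value `0`). [cite: KawanoueMatsuki2018, Def. 6 (2)(iii)] -/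
def invSpade : Option (List ℚ × List ℚ) := lexPair δ.wordA δ.B

/-! ### Algorithm 5.1, configurations, transformations ([KM18] §5) -/

/-- `dim Sing(ℛ)_P = 0`: no component `D ∈ E_young` through `P` has `H(ξ_D) ≥ 1`; algorithm 5.1 then blows up `P`.
[cite: KawanoueMatsuki2018, 5.1 (Sing), Step 2] -/
def CentreIsPoint : Prop := ∀ D ∈ δ.young, δ.Hxi D < 1

/-- algorithm 5.1 blows up the curve `V(x, x_D)`: `H(ξ_D) ≥ 1` and `H(ξ_D)` is maximal (ties are broken by the index of the
divisor, not recorded here). [cite: KawanoueMatsuki2018, 5.1 Step 2] -/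
def CentreIsCurve (D : ι) : Prop := D ∈ δ.young ∧ 1 ≤ δ.Hxi D ∧ ∀ D' ∈ δ.young, δ.Hxi D' ≤ δ.Hxi D

/-- the configuration `1, …, 5` of 5.2 by (number of components of `E_young` through `P`, number of bad ones);
`0` when no component passes through `P`. [cite: KawanoueMatsuki2018, 5.2] -/
def config : ℕ :=
  match δ.young.card, δ.bad.card with
  | 0, _ => 0
  | 1, 0 => 1
  | 2, 0 => 2
  | 1, _ => 3
  | 2, 1 => 4
  | _, _ => 5

variable (δ' : Datum ι)

/-- the point blow-up `P ← P̃` is esoteric iff `A < Ã` (else standard). [cite: KawanoueMatsuki2018, Def. 8] -/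
def Esoteric : Prop := WordLT δ.wordA δ'.wordA

/-- `inv_{MON,♠}` strictly increases from `P` to `P̃`. [cite: KawanoueMatsuki2018, Def. 6, Prop. 3] -/
def Increases : Prop := PairLT δ.invSpade δ'.invSpade

/-- `inv_{MON,♠}` strictly decreases from `P` to `P̃` (the conclusion of Prop. 3 (b) for a standard point blow-up of the
algorithm at a non-tight point). [cite: KawanoueMatsuki2018, Prop. 3] -/
def Decreases : Prop := PairLT δ'.invSpade δ.invSpade

/-- Moh's inequality (♣2) for a jump `P ← P̃` into configuration 3 with bad divisor `D̃`:
`(w-ρ_{D̃}(P̃) − inv_{MON,♥}(P))·p^e ≤ p^{e−1}`, written `p·(…)·p^e ≤ p^e`. [cite: KawanoueMatsuki2018, Prop. 6 (♣2)] -/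
def MohJumpBound (p : ℕ) (Dnew : ι) : Prop := (p : ℚ) * ((δ'.wrho Dnew - δ.invHeart) * δ.q) ≤ δ.q

/-- tightness is `inv_{MON,♥} = 0` by definition. [cite: KawanoueMatsuki2018, Def. 7] -/
theorem isTight_iff : δ.IsTight ↔ δ.invHeart = 0 := Iff.rfl

/-- a bad point is not a good point. [cite: KawanoueMatsuki2018, Def. 4 (1)] -/
theorem not_isGoodPoint_iff : ¬ δ.IsGoodPoint ↔ (δ.d : ℚ) / δ.q < δ.muP := by
  unfold IsGoodPoint; exact not_le

end Datum

end IFPMonomial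

end Literature.AlgebraicGeometry.Resolution
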